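import Literature.AnabelianGeometry.EtaleTheta.Discharge.Sec5RootOfRootModelSections

/-!
# [EtTh] Rmk. 4.3.2 «compatible systems of roots» at the canonical model, I: the refinement STEP and the root data
# on a PRESCRIBED covering object (building blocks of a cofinal chain of coverings with coherent roots)

Mochizuki, *The étale theta function and its Frobenioid-theoretic manifestations*, Publ. RIMS **45** (2009), Rmk. 4.3.2
pp. 318–319 (PDF pp. 92–93): «… such a "morphism" may be constructed by extracting an "`N′/N`-th root" [cf. Proposition 4.2,
(iii)] of the [fraction-pair determined by the] given "`N`-th root" … by allowing `N` to vary, we obtain a compatible system of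
roots of the fraction-pair `(s′, s″)`» [cite: MochizukiEtTh2009, Rmk 4.3.2 p.318 (PDF p.92)]; Prop. 4.2 (iii) proof p. 315
(PDF p. 89) (ERRATUM E2 covering, [FrdII] Rmk. 2.2.1 refinement).

abc-iut cell, layer L2, PROOF-ONLY companion (0 `def`s; seat abc-iut-w5-d134 gen 4) of this seat's
`Sec5RootOfRootModel.lean` (p433723), `Sec5RootOfRootModelSections.lean` (p434932/p435479) and `Sec5RootTransitionsModel.lean`
(p437189/p437617).  Purpose: the two reusable steps of a COHERENT construction of roots along a chain of coverings
`A ← E₀ ← E₁ ← ⋯` (each step extracts a root OF THE PREVIOUS ROOT, so `g_{k+1}^{d_k} = ψ_k^* g_k` holds on the nose), from which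
the `R N` and the Rmk. 4.3.2 transitions of abc-iut-L2-t4's `ThetaFrobenioidTower.ofBiKummerFamily` are assembled WITHOUT any
choice of roots of unity.  Nothing landed is edited or restated.

* `exists_refinedRoot_step_mkOfModelCanonical` — from the ERRATUM-E2 root law `hR` (G-w4d044-3) and a MULTI-LEVEL refinement law
  `hEdiv` ([FrdII] Rmk. 2.2.1 at all divisors of a level `M` jointly — GAP G-w5d134g4-1 family form; arithmetic producer:
  abc-iut-w5-d237's `exists_forall_isNHSaturated_ofLocalField_family`, p437069): over a Frobenius-trivial `E` with Galois base and
  `g ∈ O^×(E^birat)`, a pull-back morphism `ψ : E′ → E` from a Frobenius-trivial Galois `μ_M`-saturated `E′` satisfying Def. 4.1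
  (iii)(a) at every level dividing `M`, with a `d`-th root `g′` of `ψ^* g`, and `E′` NORMALISED against any prescribed
  skeletal family `Old` of Frobenius-trivial Galois objects (`E′ = z` whenever `E′^bs ≅ z^bs`, `z ∈ Old`) — [FrdI] Thm. 5.1 (iii)
  base-triviality.
* `exists_rootData_of_node_mkOfModelCanonical` — over a PRESCRIBED covering `φ : E → A` (pull-back, `E` Frobenius-trivial Galois
  `μ_N`-saturated with Def. 4.1 (iii)(a) at `N`, `E = A` whenever `E^bs ≅ A^bs`) and a PRESCRIBED `N`-th root `g_N` of `φ^* f`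
  (`f` fixed by `H_A`): the remaining fields of an `N`-th root datum of a right fraction-pair `P` of `f` — the codomain `B_N`, the
  root's fraction-pair `Q` (L02 `RootFractionPair` in the instance with distinguished object `A`), `α`, `β`, the base-Frobenius-type
  data and the `(N, H_⊙, ·)`-saturation (`exists_rootSquares_of_cover_mkOfModelCanonical`) — so that the datum
  `{AN := E, root := g_N, pair := Q, …}` is assembled with its `N`-domain and root DEFINITIONALLY the prescribed ones.

HONEST FRAMING: kernel-checked consequences of the named laws for data so typed; nothing asserts that such data exist for an
actual curve; no side is taken on [IUTchIII] Cor. 3.12; typed ≠ proved for the laws.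
-/

noncomputable section

namespace Literature.AnabelianGeometry.EtaleTheta

open CategoryTheory Opposite Literature.AlgebraicGeometry.Frobenioids

universe u₀ v₀ u v w

namespace BiKummerSetting

section Canonical

variable {K : Type u₀} [Field K] (X : SemiGraphs.TemperedArithmeticGroup.{u₀} K) {D₀ : Type u₀}
  [Category.{v₀} D₀] {V : FrdIMonoidStub.{w}} {T : RealifiedDivisorMonoids (D₀ := D₀) V}
  {D : Type u} [Category.{v} D] {VD : FrdICatStub.{u, v, w} D}
  (tf : TemperedFrobenioid T D VD) (hZ : tf.monoidType = MonoidType.Z)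
  (hP : ∀ A : Dᵒᵖ, IsPerfect (tf.Φ.carrier A)) (IG : D → Prop) (gS : ∀ A : D, IG A → (X.Pi →* Aut A))
  (gSs : ∀ (A : D) (h : IG A), Function.Surjective (gS A h))
  (NH : Subgroup (Field.absoluteGaloisGroup K) → tf.category → ℕ+ → Prop) (A₀ : tf.category)
  (hA₀ : PreFrobenioid.IsFrobeniusTrivial tf.toElem A₀) (hA₀' : IG A₀.base)
  (hΦd : Objectwise (fun M _ => IsDivisorial M) tf.divisorMonoid)

include hΦd in
/-- **The refinement step of the chain**: see the module docstring.  [cite: MochizukiEtTh2009, Prop 4.2 (iii) p.315 (PDF p.89)] -/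
theorem exists_refinedRoot_step_mkOfModelCanonical
    (hR : ∀ (N : ℕ+) (A : D), IG A → ∀ f : tf.ratFnFunctor.obj (op A),
      ∃ (A' : D) (_ : IG A') (b : A' ⟶ A) (g : tf.ratFnFunctor.obj (op A')),
        g ^ (N : ℕ) = pull tf.ratFnFunctor b f)
    (hEdiv : ∀ (M : ℕ+) (A' : tf.category), PreFrobenioid.IsFrobeniusTrivial tf.toElem A' → IG A'.base →
      ∃ (A'' : tf.category) (ψ : A'' ⟶ A'), PreFrobenioid.IsPullbackMorphism tf.toElem ψ ∧ IG A''.base ∧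
        tf.IsMuSaturated A'' M ∧
          ∀ N : ℕ+, (N : ℕ) ∣ (M : ℕ) → NH (mkOfModelCanonical X tf hZ hP IG gS gSs NH A₀ hA₀ hA₀').HodotBsFld A'' N)
    {E : tf.category} (hEft : PreFrobenioid.IsFrobeniusTrivial tf.toElem E) (hEG : IG E.base)
    (g : tf.biratUnitsModel E) (d M : ℕ+) (Old : tf.category → Prop)
    (hOft : ∀ z, Old z → PreFrobenioid.IsFrobeniusTrivial tf.toElem z) (hOG : ∀ z, Old z → IG z.base)
    (hOsk : ∀ z z', Old z → Old z' → Nonempty (z.base ≅ z'.base) → z = z') :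
    ∃ (E' : tf.category) (ψ : E' ⟶ E) (g' : tf.biratUnitsModel E'),
      PreFrobenioid.IsPullbackMorphism tf.toElem ψ ∧ PreFrobenioid.IsFrobeniusTrivial tf.toElem E' ∧ IG E'.base ∧
        g' ^ (d : ℕ) = tf.pullFracModel ψ g ∧ tf.IsMuSaturated E' M ∧
          (∀ N : ℕ+, (N : ℕ) ∣ (M : ℕ) → ∃ (A₁ A₂ : tf.category) (s₁ : A₁ ⟶ E') (s₂ : A₁ ⟶ A₂),
            (mkOfModelCanonical X tf hZ hP IG gS gSs NH A₀ hA₀ hA₀').IsPreStep s₁ ∧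
              (mkOfModelCanonical X tf hZ hP IG gS gSs NH A₀ hA₀ hA₀').IsPreStep s₂ ∧
                (mkOfModelCanonical X tf hZ hP IG gS gSs NH A₀ hA₀ hA₀').IsFrobeniusTrivial A₂ ∧
                  (mkOfModelCanonical X tf hZ hP IG gS gSs NH A₀ hA₀ hA₀').IsNHSaturatedBsFld
                    (mkOfModelCanonical X tf hZ hP IG gS gSs NH A₀ hA₀ hA₀').HodotBsFld A₂ N) ∧
            (∀ z, Old z → Nonempty (E'.base ≅ z.base) → E' = z) := by
  have hBg := tf.isGroupLike_ratFnFunctor T.isUnit_BΛ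
  -- ERRATUM E2: a `d`-th root of `g` over a Galois base covering, on the pull-back object
  obtain ⟨A', hA', b, r, hr⟩ := hR d E.base hEG ((show tf.biratUnitsModel E from g) : tf.ratFnFunctor.obj (op E.base))
  obtain ⟨W, δ, r', hWb, hδ, hr'⟩ :=
    (mkOfModelCanonical X tf hZ hP IG gS gSs NH A₀ hA₀ hA₀').exists_isPullback_over_baseHom hΦd hBg E b hr
  have hWft : PreFrobenioid.IsFrobeniusTrivial tf.toElem W :=
    (mkOfModelCanonical X tf hZ hP IG gS gSs NH A₀ hA₀ hA₀').isFrobeniusTrivial_of_isPullback hΦd hBg hδ hEft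
  have hWG : IG W.base := by
    rw [hWb]
    exact hA'
  -- [FrdII] Rmk. 2.2.1 at all levels dividing `M`
  obtain ⟨A'', ψ, hψ, hG'', hμM, hNH⟩ := hEdiv M W hWft hWG
  have hft'' : PreFrobenioid.IsFrobeniusTrivial tf.toElem A'' :=
    (mkOfModelCanonical X tf hZ hP IG gS gSs NH A₀ hA₀ hA₀').isFrobeniusTrivial_of_isPullback hΦd hBg hψ hWft
  have hφ₁ : (mkOfModelCanonical X tf hZ hP IG gS gSs NH A₀ hA₀ hA₀').IsPullback (ψ ≫ δ) :=
    (mkOfModelCanonical X tf hZ hP IG gS gSs NH A₀ hA₀ hA₀').isPullback_comp hΦd hBg hψ hδ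
  have hr'' : tf.pullFracModel ψ r' ^ (d : ℕ) = tf.pullFracModel (ψ ≫ δ) g :=
    (mkOfModelCanonical X tf hZ hP IG gS gSs NH A₀ hA₀ hA₀').pullFracModel_pow_eq_of_comp ψ δ hr'
  have hid : (mkOfModelCanonical X tf hZ hP IG gS gSs NH A₀ hA₀ hA₀').IsPreStep (𝟙 A'') :=
    ⟨by change ModelFrobenioid.degFr (𝟙 A'') = 1; rfl, by
      change IsIso (ModelFrobenioid.baseMap (𝟙 A''))
      rw [ModelFrobenioid.baseMap_id]
      infer_instance⟩
  -- transport of all the data along a `C`-isomorphism `σ : A'' ≅ Z` (normalisation)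
  have transport : ∀ (Z : tf.category) (σ : A'' ≅ Z), PreFrobenioid.IsFrobeniusTrivial tf.toElem Z → IG Z.base →
      (∀ z, Old z → Nonempty (Z.base ≅ z.base) → Z = z) →
      ∃ (E' : tf.category) (ψ : E' ⟶ E) (g' : tf.biratUnitsModel E'),
        PreFrobenioid.IsPullbackMorphism tf.toElem ψ ∧ PreFrobenioid.IsFrobeniusTrivial tf.toElem E' ∧ IG E'.base ∧
          g' ^ (d : ℕ) = tf.pullFracModel ψ g ∧ tf.IsMuSaturated E' M ∧
            (∀ N : ℕ+, (N : ℕ) ∣ (M : ℕ) → ∃ (A₁ A₂ : tf.category) (s₁ : A₁ ⟶ E') (s₂ : A₁ ⟶ A₂),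
              (mkOfModelCanonical X tf hZ hP IG gS gSs NH A₀ hA₀ hA₀').IsPreStep s₁ ∧
                (mkOfModelCanonical X tf hZ hP IG gS gSs NH A₀ hA₀ hA₀').IsPreStep s₂ ∧
                  (mkOfModelCanonical X tf hZ hP IG gS gSs NH A₀ hA₀ hA₀').IsFrobeniusTrivial A₂ ∧
                    (mkOfModelCanonical X tf hZ hP IG gS gSs NH A₀ hA₀ hA₀').IsNHSaturatedBsFld
                      (mkOfModelCanonical X tf hZ hP IG gS gSs NH A₀ hA₀ hA₀').HodotBsFld A₂ N) ∧
              (∀ z, Old z → Nonempty (E'.base ≅ z.base) → E' = z) := by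
    intro Z σ hZft hZG hZsk
    refine ⟨Z, σ.inv ≫ ψ ≫ δ, tf.pullFracModel σ.inv (tf.pullFracModel ψ r'), ?_, hZft, hZG, ?_, ?_, ?_, hZsk⟩
    · exact PreFrobenioid.IsPullbackMorphism.comp _ (PreFrobenioid.isPullbackMorphism_of_isIso _ σ.inv) hφ₁
    · exact (mkOfModelCanonical X tf hZ hP IG gS gSs NH A₀ hA₀ hA₀').pullFracModel_pow_eq_of_comp σ.inv (ψ ≫ δ) hr''
    · exact (mkOfModelCanonical X tf hZ hP IG gS gSs NH A₀ hA₀ hA₀').isMuSaturated_of_iso σ hμM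
    · intro N hN
      exact ⟨A'', A'', 𝟙 A'' ≫ σ.hom, 𝟙 A'', ModelFrobenioid.isPreStep_comp_of_isIso hid σ.hom, hid, hft'', hNH N hN⟩
  by_cases h : ∃ z, Old z ∧ Nonempty (A''.base ≅ z.base)
  · obtain ⟨z, hz, ⟨e⟩⟩ := h
    obtain ⟨σ, -⟩ := (mkOfModelCanonical X tf hZ hP IG gS gSs NH A₀ hA₀ hA₀').exists_iso_baseMap_eq_of_isFrobeniusTrivial
      hBg hft'' (hOft z hz) e
    exact transport z σ (hOft z hz) (hOG z hz) (fun z' hz' hne => hOsk z z' hz hz' hne)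
  · exact transport A'' (Iso.refl A'') hft'' hG'' (fun z' hz' hne => (h ⟨z', hz', hne⟩).elim)

include hΦd in
/-- **The root datum on a PRESCRIBED covering object with a PRESCRIBED root** (Prop. 4.2 (iii) data, domain of a given root or
`A_⊙`): see the module docstring — L02 in the instance with distinguished object `A` supplies the codomain `B_N` and the root's
fraction-pair `Q`; `exists_rootSquares_of_cover_mkOfModelCanonical` the rest.  The `N`-domain `E` and the root `g_N` stay outside
the existential.  [cite: MochizukiEtTh2009, Prop 4.2 (iii) p.314–315 (PDF pp.88–89)] -/
theorem exists_rootData_of_node_mkOfModelCanonical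
    (hDSpull : ∀ {A A' : D} (e : A' ⟶ A) {a b : tf.Φ.carrier (op A)},
      (∀ x : tf.Φ.carrier (op A), x ∣ a → x ∣ b → x = 1) →
        ∀ y : tf.Φ.carrier (op A'), y ∣ pull tf.divisorMonoid e a → y ∣ pull tf.divisorMonoid e b → y = 1)
    (hS : ∀ ⦃A B : D⦄ (hA : IG A) (hB : IG B) (b : B ⟶ A),
      ∃ c : X.Pi, ∀ g : X.Pi, (gS B hB g).hom ≫ b = b ≫ (gS A hA (c * g * c⁻¹)).hom)
    {A B : tf.category} (hAft : PreFrobenioid.IsFrobeniusTrivial tf.toElem A) (hAG : IG A.base)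
    {f : tf.biratUnitsModel A} (hfix : (mkOfModelCanonical X tf hZ hP IG gS gSs NH A₀ hA₀ hA₀').IsFixedByHA A hAG f)
    (P : (mkOfModelCanonical X tf hZ hP IG gS gSs NH A₀ hA₀ hA₀').FractionPair f B) (N : ℕ+)
    {E : tf.category} (φ : E ⟶ A) (hφ : PreFrobenioid.IsPullbackMorphism tf.toElem φ)
    (hft : PreFrobenioid.IsFrobeniusTrivial tf.toElem E) (hG : IG E.base)
    (hsk₁ : Nonempty (E.base ≅ A.base) → E = A) (hμN : tf.IsMuSaturated E N)
    (hcN : ∃ (A₁ A₂ : tf.category) (s₁ : A₁ ⟶ E) (s₂ : A₁ ⟶ A₂),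
      (mkOfModelCanonical X tf hZ hP IG gS gSs NH A₀ hA₀ hA₀').IsPreStep s₁ ∧
        (mkOfModelCanonical X tf hZ hP IG gS gSs NH A₀ hA₀ hA₀').IsPreStep s₂ ∧
          (mkOfModelCanonical X tf hZ hP IG gS gSs NH A₀ hA₀ hA₀').IsFrobeniusTrivial A₂ ∧
            (mkOfModelCanonical X tf hZ hP IG gS gSs NH A₀ hA₀ hA₀').IsNHSaturatedBsFld
              (mkOfModelCanonical X tf hZ hP IG gS gSs NH A₀ hA₀ hA₀').HodotBsFld A₂ N)
    {gN : tf.biratUnitsModel E} (hgN : gN ^ (N : ℕ) = tf.pullFracModel φ f) :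
    ∃ (BN : tf.category) (Q : (mkOfModelCanonical X tf hZ hP IG gS gSs NH A₀ hA₀ hA₀').FractionPair gN BN)
      (α : E ⟶ A) (β : BN ⟶ B) (d : (mkOfModelCanonical X tf hZ hP IG gS gSs NH A₀ hA₀ hA₀').BaseFrobeniusTypeData α),
      (mkOfModelCanonical X tf hZ hP IG gS gSs NH A₀ hA₀ hA₀').IsIsometry α ∧
        (mkOfModelCanonical X tf hZ hP IG gS gSs NH A₀ hA₀ hA₀').IsIsometry β ∧
          (mkOfModelCanonical X tf hZ hP IG gS gSs NH A₀ hA₀ hA₀').degFr α = N ∧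
            (mkOfModelCanonical X tf hZ hP IG gS gSs NH A₀ hA₀ hA₀').degFr β = N ∧
              Q.num ≫ β = α ≫ P.num ∧ Q.den ≫ β = α ≫ P.den ∧
                ModelFrobenioid.baseMap d.α₁ = ModelFrobenioid.baseMap φ ∧
                  gN ^ (N : ℕ) = tf.pullFracModel d.α₁ f ∧
                    (mkOfModelCanonical X tf hZ hP IG gS gSs NH A₀ hA₀ hA₀').IsSaturated E N (tf.pullFracModel d.α₁ f) := by
  -- L02 in the instance with distinguished object `A`: the codomain and the fraction-pair of the prescribed root
  obtain ⟨BN, QA, hQn, hQd⟩ := rootFractionPair_mkOfModel tf hZ hP T.isUnit_BΛ _ IG gS gSs NH _ A hAft hAG hΦd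
    (fun N h x hxa hxb => h x (dvd_pow hxa (PNat.ne_zero N)) (dvd_pow hxb (PNat.ne_zero N))) hDSpull f
    (⟨P.num, P.den, P.isPreStep_num, P.isPreStep_den, P.base_eq, P.frac_eq, P.disjointSupports⟩ :
      (mkOfModelCanonical X tf hZ hP IG gS gSs NH A hAft hAG).FractionPair f B)
    N E φ gN hφ hgN
  obtain ⟨α, β, d, hiso, hβiso, hdeg, hβdeg, hcn, hcd, hb₁, hg, hsat⟩ :=
    exists_rootSquares_of_cover_mkOfModelCanonical X tf hZ hP IG gS gSs NH A₀ hA₀ hA₀' hΦd hS hAft hAG hfix P N φ hφ hft hG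
      hsk₁ hμN hcN hgN
      (⟨QA.num, QA.den, QA.isPreStep_num, QA.isPreStep_den, QA.base_eq, QA.frac_eq, QA.disjointSupports⟩ :
        (mkOfModelCanonical X tf hZ hP IG gS gSs NH A₀ hA₀ hA₀').FractionPair gN BN)
      hQn hQd
  exact ⟨BN, ⟨QA.num, QA.den, QA.isPreStep_num, QA.isPreStep_den, QA.base_eq, QA.frac_eq, QA.disjointSupports⟩, α, β, d,
    hiso, hβiso, hdeg, hβdeg, hcn, hcd, hb₁, hg, hsat⟩

end Canonical

end BiKummerSetting

end Literature.AnabelianGeometry.EtaleTheta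

end
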